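import Summits.CriticalPhenomena.SAWScalingLimit.Theorems.SAWWeldingIdentificationWeldingSetup

/-!
# Welding marginals pass to chord-supported weak limits (crux `WeldingLawOfLimit`, stmt-4502)

Route `SAWWeldingIdentification` of `CriticalPhenomena/SAWScalingLimit`, crux (W)
`WeldingLawOfLimit`, line `registered`, stub `stub_weldingMarginalsOfLimit` (skeleton v3, lead c3):
if probability measures `Pₙ → P` converge weakly on `CurveClass ℂ` and all of them, as well as
`P`, are carried by the simple chords of the Dobrushin domain `(Ω; a, b) = Q.chord 0 2` of a
conformal rectangle `Q`, then for every `k`, every `x : Fin k → ℝ` and every bounded continuous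
`g` on `ℝᵏ` the welding marginals converge:
`∫ g (conformalWelding Q γ xᵢ)ᵢ dPₙ → ∫ g (conformalWelding Q γ xᵢ)ᵢ dP`.

## Proof

A **continuous-mapping theorem on a carrying set** (`tendsto_map_of_continuousOn_of_null`):
if `μs i → μ` weakly, `ψ` is Borel and continuous ON a set `S` (`ContinuousOn ψ S`, i.e. only
along `S`; `ψ` may be discontinuous at every point of `S` as a map on the whole space) with
`μs i Sᶜ = 0` for all `i` and `μ Sᶜ = 0`, then `μs i ∘ ψ⁻¹ → μ ∘ ψ⁻¹` weakly. Indeed, by the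
closed-set portmanteau criterion (Mathlib `tendsto_of_forall_isClosed_limsup_le'`) it suffices
to bound `limsup μs i (ψ⁻¹ C) ≤ μ (ψ⁻¹ C)` for `C` closed; `continuousOn_iff_isClosed` provides a
closed `u` with `ψ⁻¹ C ∩ S = u ∩ S`, so `ν (ψ⁻¹ C) = ν u` for every measure `ν` carried by `S`,
and `limsup μs i u ≤ μ u` is the forward portmanteau inequality
(`ProbabilityMeasure.limsup_measure_closed_le_of_tendsto`). The welding vector
`γ ↦ (conformalWelding Q γ xᵢ)ᵢ` is Borel (`measurable_conformalWelding`) and continuous on the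
Borel set of simple chords (`continuousOn_conformalWelding`, Pommerenke 1992 Thm. 2.11 / Radó),
and weak convergence of the image laws is convergence of the integrals of bounded continuous
functions (`ProbabilityMeasure.tendsto_iff_forall_integral_tendsto`, `integral_map`).

References: P. Billingsley, *Convergence of Probability Measures*, 2nd ed. (1999), §2 (the
portmanteau and mapping theorems); Ch. Pommerenke, *Boundary Behaviour of Conformal Maps* (1992),
Thm. 2.11. No new definition, no named fact.
-/

noncomputable section

open MeasureTheory Filter Topology Set
open Literature.Probability.RandomPlanarGeometry

namespace Summit.CriticalPhenomena.SAWScalingLimit.Theorems.WeldingLawOfLimit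

/-- **Continuous mapping on a carrying set.** Let `μs i → μ` weakly (along a countably generated
filter), let `ψ : E → F'` be Borel and continuous on a set `S` (`ContinuousOn ψ S`), and suppose
`μs i Sᶜ = 0` for all `i` and `μ Sᶜ = 0`. Then the image laws converge weakly:
`μs i ∘ ψ⁻¹ → μ ∘ ψ⁻¹`. (Closed-set portmanteau: for `C` closed there is a closed `u` with
`ψ⁻¹ C ∩ S = u ∩ S`, so all the measures involved give `ψ⁻¹ C` and `u` the same mass.)
Billingsley (1999), §2. [folklore] -/
theorem tendsto_map_of_continuousOn_of_null
    {E : Type*} [MeasurableSpace E] [TopologicalSpace E] [OpensMeasurableSpace E]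
    [HasOuterApproxClosed E]
    {F' : Type*} [MeasurableSpace F'] [TopologicalSpace F'] [OpensMeasurableSpace F']
    {ι : Type*} {L : Filter ι} [L.IsCountablyGenerated]
    {μs : ι → ProbabilityMeasure E} {μ : ProbabilityMeasure E} (hlim : Tendsto μs L (𝓝 μ))
    {ψ : E → F'} (hψ : Measurable ψ) {S : Set E} (hS : ContinuousOn ψ S)
    (hμs : ∀ i, (μs i : Measure E) Sᶜ = 0) (hμ : (μ : Measure E) Sᶜ = 0) :
    Tendsto (fun i => (μs i).map hψ.aemeasurable) L (𝓝 (μ.map hψ.aemeasurable)) := by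
  refine tendsto_of_forall_isClosed_limsup_le' fun C hC => ?_
  obtain ⟨u, hu, huS⟩ := continuousOn_iff_isClosed.1 hS C hC
  have key : ∀ ν : Measure E, ν Sᶜ = 0 → ν (ψ ⁻¹' C) = ν u := fun ν hν => by
    rw [← measure_inter_conull (s := ψ ⁻¹' C) hν, huS, measure_inter_conull hν]
  have hrw : ∀ i, (((μs i).map hψ.aemeasurable : ProbabilityMeasure F') : Measure F') C =
      (μs i : Measure E) u := fun i => by
    rw [ProbabilityMeasure.toMeasure_map, Measure.map_apply hψ hC.measurableSet, key _ (hμs i)]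
  have hrw' : ((μ.map hψ.aemeasurable : ProbabilityMeasure F') : Measure F') C =
      (μ : Measure E) u := by
    rw [ProbabilityMeasure.toMeasure_map, Measure.map_apply hψ hC.measurableSet, key _ hμ]
  simp_rw [hrw, hrw']
  exact ProbabilityMeasure.limsup_measure_closed_le_of_tendsto hlim hu

/-- **Welding marginals pass to chord-supported weak limits** (stub `stub_weldingMarginalsOfLimit`
of crux `WeldingLawOfLimit`, stmt-CriticalPhenomena-4502, verbatim). If probability measures
`Pₙ → P` weakly on `CurveClass ℂ`, all carried by the simple chords of `(Ω; a, b) = Q.chord 0 2`,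
then for every `k`, `x : Fin k → ℝ` and bounded continuous `g` on `ℝᵏ`,
`∫ g (conformalWelding Q γ xᵢ)ᵢ dPₙ → ∫ g (conformalWelding Q γ xᵢ)ᵢ dP`: the continuous-mapping
theorem on the carrying Borel set of simple chords (`tendsto_map_of_continuousOn_of_null`), where
the welding vector is continuous (`continuousOn_conformalWelding`) and Borel
(`measurable_conformalWelding`). Billingsley (1999) §2; Pommerenke (1992) Thm. 2.11. [folklore] -/
theorem weldingMarginalsOfLimit :
    ∀ (Q : ConformalRectangle) (Ps : ℕ → Measure (CurveClass ℂ)) (P : Measure (CurveClass ℂ)),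
    (∀ n, IsProbabilityMeasure (Ps n)) → IsProbabilityMeasure P →
    (∀ n, ∀ᵐ γ ∂(Ps n), (Q.chord 0 2 (by decide)).IsSimpleChord γ) →
    (∀ᵐ γ ∂P, (Q.chord 0 2 (by decide)).IsSimpleChord γ) →
    (∀ f : BoundedContinuousFunction (CurveClass ℂ) ℝ,
      Tendsto (fun n => ∫ γ, f γ ∂(Ps n)) atTop (𝓝 (∫ γ, f γ ∂P))) →
    ∀ (k : ℕ) (x : Fin k → ℝ) (g : BoundedContinuousFunction (Fin k → ℝ) ℝ),
      Tendsto (fun n => ∫ γ, g (fun i => conformalWelding Q γ (x i)) ∂(Ps n)) atTop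
        (𝓝 (∫ γ, g (fun i => conformalWelding Q γ (x i)) ∂P)) := by
  intro Q Ps P hPs hP hPsch hPch hlim k x g
  -- the welding vector: Borel, and continuous on the Borel set of simple chords
  have hVm : Measurable fun (γ : CurveClass ℂ) (i : Fin k) => conformalWelding Q γ (x i) :=
    measurable_pi_lambda _ fun i => measurable_conformalWelding Q (x i)
  have hVc : ContinuousOn (fun (γ : CurveClass ℂ) (i : Fin k) => conformalWelding Q γ (x i))
      {γ | (Q.chord 0 2 (by decide)).IsSimpleChord γ} :=
    continuousOn_pi.2 fun i => continuousOn_conformalWelding Q (x i)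
  -- the laws as `ProbabilityMeasure`s, converging weakly
  let μs : ℕ → ProbabilityMeasure (CurveClass ℂ) := fun n => ⟨Ps n, hPs n⟩
  let μ : ProbabilityMeasure (CurveClass ℂ) := ⟨P, hP⟩
  have hw : Tendsto μs atTop (𝓝 μ) :=
    ProbabilityMeasure.tendsto_iff_forall_integral_tendsto.2 hlim
  have hSμs : ∀ n, (μs n : Measure (CurveClass ℂ))
      {γ | (Q.chord 0 2 (by decide)).IsSimpleChord γ}ᶜ = 0 := fun n => mem_ae_iff.1 (hPsch n)
  have hSμ : (μ : Measure (CurveClass ℂ)) {γ | (Q.chord 0 2 (by decide)).IsSimpleChord γ}ᶜ = 0 :=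
    mem_ae_iff.1 hPch
  -- continuous mapping on the carrying set, read on bounded continuous functions
  have hmap := tendsto_map_of_continuousOn_of_null hw hVm hVc hSμs hSμ
  have hint := ProbabilityMeasure.tendsto_iff_forall_integral_tendsto.1 hmap g
  have e1 : ∀ n, ∫ y, g y ∂(((μs n).map hVm.aemeasurable : ProbabilityMeasure (Fin k → ℝ)) :
      Measure (Fin k → ℝ)) = ∫ γ, g (fun i => conformalWelding Q γ (x i)) ∂(Ps n) := fun n => by
    rw [ProbabilityMeasure.toMeasure_map]
    exact integral_map hVm.aemeasurable g.continuous.aestronglyMeasurable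
  have e2 : ∫ y, g y ∂((μ.map hVm.aemeasurable : ProbabilityMeasure (Fin k → ℝ)) :
      Measure (Fin k → ℝ)) = ∫ γ, g (fun i => conformalWelding Q γ (x i)) ∂P := by
    rw [ProbabilityMeasure.toMeasure_map]
    exact integral_map hVm.aemeasurable g.continuous.aestronglyMeasurable
  rw [e2] at hint
  exact hint.congr e1

/-- **Registered stub `stub_weldingMarginalsOfLimit`** of crux `WeldingLawOfLimit`
(stmt-CriticalPhenomena-4502), line `registered`, skeleton v3: the unfolded body of the skeleton's
`WeldingMarginalsOfLimit`, under the registered stub name (an alias of `weldingMarginalsOfLimit`,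
so that the skeleton closes its stub by `exact` on either name). [folklore] -/
theorem stub_weldingMarginalsOfLimit :
    ∀ (Q : ConformalRectangle) (Ps : ℕ → Measure (CurveClass ℂ)) (P : Measure (CurveClass ℂ)),
    (∀ n, IsProbabilityMeasure (Ps n)) → IsProbabilityMeasure P →
    (∀ n, ∀ᵐ γ ∂(Ps n), (Q.chord 0 2 (by decide)).IsSimpleChord γ) →
    (∀ᵐ γ ∂P, (Q.chord 0 2 (by decide)).IsSimpleChord γ) →
    (∀ f : BoundedContinuousFunction (CurveClass ℂ) ℝ,
      Tendsto (fun n => ∫ γ, f γ ∂(Ps n)) atTop (𝓝 (∫ γ, f γ ∂P))) →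
    ∀ (k : ℕ) (x : Fin k → ℝ) (g : BoundedContinuousFunction (Fin k → ℝ) ℝ),
      Tendsto (fun n => ∫ γ, g (fun i => conformalWelding Q γ (x i)) ∂(Ps n)) atTop
        (𝓝 (∫ γ, g (fun i => conformalWelding Q γ (x i)) ∂P)) :=
  weldingMarginalsOfLimit

end Summit.CriticalPhenomena.SAWScalingLimit.Theorems.WeldingLawOfLimit

end
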